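import Literature.Computability.AlgebraicComplexity.CircuitGateSemantics
import Literature.Computability.AlgebraicComplexity.StandardFamilies
import HarnessLib

/-!
# Projections of arithmetic circuits: empty-gate pruning, variable-to-constant substitution, and
# the truncation of `IMM_{n,d}` to `IMM_{n,d'}`

Generic circuit surgery for the tree's list-presented model `ArithCircuit` (unbounded fan-in
weighted-sum and product gates, `CircuitDepth.lean`: `productDepth`, `edgeSize` = number of WIRES),
written for the border-complexity version of the Limaye–Srinivasan–Tavenas lower bound
(Andrews–Forbes 2022, Cor. 6.5; `AndrewsForbes2022BorderLST.lean`, val-lit t24) but independent of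
it.

## Content (all proved; the `def`s are plumbing, no named facts)

* `ArithCircuit.Gate.mapOps` — apply an operand transformation to every operand of a gate;
  `Gate.eval_mapOps` (semantics operandwise), fan-in and kind are kept.
* **Empty-gate pruning** (`ArithCircuit.pruneEmpty`, sub-namespace `EmptyGatePruning` for the
  bookkeeping `keep` / `newIdx` / `cval` / `rwOp` / `newGates` / `pick`): the gates `sum []` and
  `prod []` (no operands; values `0` and `1`) are deleted, references to them are replaced by the
  constants `0` / `1`, the surviving gate references are re-indexed, forward (junk) references
  become `const 0`. `eval_pruneEmpty` (same polynomial), `productDepth_pruneEmpty_le`,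
  `edgeSize_pruneEmpty_le`, and `size_pruneEmpty_le_edgeSize`: afterwards every gate has an
  operand, so **#gates ≤ #wires**. Packaged as `ArithCircuit.exists_size_le_edgeSize`. This is the
  bridge from statements typed with the wire measure (the §6 class of record of
  `AndrewsForbes2022Applications.lean`, `productDepthEdgeClass`) to engines stated with the gate
  count (`ArithCircuit.size`, e.g. `LSTWord.relRank_aeval_eval_le`).
* **Variable-to-constant substitution** (`ArithCircuit.substVC s` for `s : σ → τ ⊕ k`: `x ↦ y` or
  `x ↦ c`): `eval_substVC` (computes `aeval (substVCFun s) P.eval`), and it keeps `size`,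
  `edgeSize` and `productDepth` exactly (`size_substVC`, `edgeSize_substVC`,
  `productDepth_substVC`). Projections in Valiant's sense restricted to variables and constants.
* **Truncation of `IMM`** (`immTrunc`, `aeval_immTrunc_immMatrix`): substituting the identity
  matrix for `X^{(t)}`, `t ≥ d'`, turns `(X^{(0)} ⋯ X^{(d-1)})_{ij}` (`immMatrix`,
  `StandardFamilies.lean`) into `(X^{(0)} ⋯ X^{(d'-1)})_{ij}`; with `aeval_immMatrix_apply`
  (`aeval g` of an entry of the generic product is the entry of the product of the substituted
  matrices).

## References

* P. Bürgisser, *Completeness and Reduction in Algebraic Complexity Theory*, Springer 2000,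
  Def. 2.1 (straight-line programs; the model).
* N. Limaye, S. Srinivasan, S. Tavenas, J. ACM 72 (2025), Art. 26, §2 (size = wires,
  product-depth; `IMM_{n,d}`).
* R. Andrews, M. A. Forbes, STOC 2022, arXiv:2112.00792, §6.1 (where these are used).
-/

noncomputable section

open MvPolynomial Matrix

namespace Literature.Computability.AlgebraicComplexity

universe u v w

namespace ArithCircuit

variable {k : Type u} {σ : Type v} {τ : Type w}

/-! ### Mapping the operands of a gate -/

/-- Apply an operand transformation to every operand of a gate (coefficients of a sum gate kept).
[folklore] -/
def Gate.mapOps (f : Operand k σ → Operand k σ) : Gate k σ → Gate k σ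
  | .sum args => .sum (args.map fun a => (a.1, f a.2))
  | .prod args => .prod (args.map f)

/-- Operands of a mapped gate. [cite: Burgisser2000, Def. 2.1] -/
theorem Gate.args_mapOps (f : Operand k σ → Operand k σ) (g : Gate k σ) :
    (g.mapOps f).args = g.args.map f := by
  cases g <;> simp [Gate.mapOps, Gate.args, List.map_map, Function.comp_def]

/-- Mapping operands keeps the fan-in. [cite: Burgisser2000, Def. 2.1] -/
@[simp] theorem Gate.fanIn_mapOps (f : Operand k σ → Operand k σ) (g : Gate k σ) :
    (g.mapOps f).fanIn = g.fanIn := by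
  simp [Gate.fanIn, Gate.args_mapOps]

/-- Mapping operands keeps the kind of the gate. [cite: Burgisser2000, Def. 2.1] -/
@[simp] theorem Gate.isProd_mapOps (f : Operand k σ → Operand k σ) (g : Gate k σ) :
    (g.mapOps f).isProd = g.isProd := by
  cases g <;> rfl

/-- Semantics of a mapped gate: if every mapped operand evaluates (against `W`) to the value of the
original operand (against `V`), the mapped gate evaluates against `W` to the value of the gate
against `V`. [cite: Burgisser2000, Def. 2.1] -/
theorem Gate.eval_mapOps [CommSemiring k] (f : Operand k σ → Operand k σ) (g : Gate k σ)
    (V W : List (MvPolynomial σ k)) (h : ∀ u ∈ g.args, (f u).eval W = u.eval V) :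
    (g.mapOps f).eval W = g.eval V := by
  cases g with
  | sum args =>
    simp only [Gate.mapOps, Gate.eval, List.map_map, Function.comp_def]
    congr 1
    refine List.map_congr_left fun a ha => ?_
    rw [h a.2 (by simp only [Gate.args, List.mem_map]; exact ⟨a, ha, rfl⟩)]
  | prod args =>
    simp only [Gate.mapOps, Gate.eval, List.map_map, Function.comp_def]
    congr 1
    exact List.map_congr_left fun a ha => h a ha

/-- The weighted depth of a mapped gate, compared operandwise. [cite: Burgisser2000, Def. 2.1] -/
theorem foldr_max_map_le_of_forall {α : Type*} (l : List α) (f g : α → ℕ)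
    (h : ∀ x ∈ l, f x ≤ g x) : (l.map f).foldr max 0 ≤ (l.map g).foldr max 0 := by
  induction l with
  | nil => simp
  | cons a l ih =>
    simp only [List.map_cons, List.foldr_cons]
    exact max_le_max (h a (by simp)) (ih fun x hx => h x (by simp [hx]))

/-- A gate with no operands is `sum []` or `prod []`. [cite: Burgisser2000, Def. 2.1] -/
theorem Gate.eq_of_fanIn_eq_zero {g : Gate k σ} (h : g.fanIn = 0) :
    g = .sum [] ∨ g = .prod [] := by
  cases g with
  | sum args =>
    left
    simp only [Gate.fanIn, Gate.args, List.length_map, List.length_eq_zero_iff] at h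
    rw [h]
  | prod args =>
    right
    simp only [Gate.fanIn, Gate.args, List.length_eq_zero_iff] at h
    rw [h]

/-! ### Empty-gate pruning -/

namespace EmptyGatePruning

variable (G : List (Gate k σ))

/-- Gate `j` of `G` is kept iff it exists and has at least one operand. [folklore] -/
def keep (j : ℕ) : Bool :=
  match G[j]? with
  | some g => decide (g.fanIn ≠ 0)
  | none => false

/-- The index of (kept) gate `j` in the pruned list: the number of kept gates before it. [folklore] -/
def newIdx (j : ℕ) : ℕ := ((List.range j).filter fun j' => keep G j').length

/-- The constant value of an empty gate: `1` for `prod []`, `0` for `sum []` (and junk). [folklore] -/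
def cval [Zero k] [One k] (j : ℕ) : k :=
  match G[j]? with
  | some (.prod _) => 1
  | _ => 0

/-- Operand rewriting at (old) position `i`: references to kept earlier gates are re-indexed,
references to empty earlier gates become their constant value, forward references become
`const 0` (their junk value). [folklore] -/
def rwOp [Zero k] [One k] (i : ℕ) : Operand k σ → Operand k σ
  | .var x => .var x
  | .const c => .const c
  | .gate j => if j < i then (if keep G j then .gate (newIdx G j) else .const (cval G j))
      else .const 0

/-- The pruned version of the first `i` gates: rewrite operands, then drop the empty gates.
[folklore] -/
def newGates [Zero k] [One k] (i : ℕ) : List (Gate k σ) :=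
  ((G.take i).mapIdx fun j g => g.mapOps (rwOp G j)).filter fun g => decide (g.fanIn ≠ 0)

/-- Picking the entries of a list at the kept indices `< i`. [folklore] -/
def pick {α : Type*} (i : ℕ) (V : List α) (dflt : α) : List α :=
  ((List.range i).filter fun j' => keep G j').map fun j => V.getD j dflt

variable {G}

/-- Bookkeeping for the circuit projections (`keep_of_getElem?`). [cite: AndrewsForbes2022, §6.1 (circuit size: wires vs. gates; cf. LST 2025 §2)] -/
theorem keep_of_getElem? {j : ℕ} {g : Gate k σ} (hg : G[j]? = some g) :
    keep G j = decide (g.fanIn ≠ 0) := by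
  simp [keep, hg]

/-- Bookkeeping for the circuit projections (`keep_eq_false_of_le`). [cite: AndrewsForbes2022, §6.1 (circuit size: wires vs. gates; cf. LST 2025 §2)] -/
theorem keep_eq_false_of_le {j : ℕ} (hj : G.length ≤ j) : keep G j = false := by
  simp [keep, List.getElem?_eq_none_iff.2 hj]

/-- Bookkeeping for the circuit projections (`newIdx_succ`). [cite: AndrewsForbes2022, §6.1 (circuit size: wires vs. gates; cf. LST 2025 §2)] -/
theorem newIdx_succ (j : ℕ) : newIdx G (j + 1) = newIdx G j + (if keep G j then 1 else 0) := by
  simp only [newIdx, List.range_succ, List.filter_append, List.length_append]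
  congr 1
  by_cases h : keep G j = true <;> simp [h]

/-- Bookkeeping for the circuit projections (`newIdx_mono`). [cite: AndrewsForbes2022, §6.1 (circuit size: wires vs. gates; cf. LST 2025 §2)] -/
theorem newIdx_mono {j j' : ℕ} (h : j ≤ j') : newIdx G j ≤ newIdx G j' := by
  induction h with
  | refl => exact le_rfl
  | step _ ih => rw [newIdx_succ]; omega

/-- Bookkeeping for the circuit projections (`newIdx_lt_of_keep`). [cite: AndrewsForbes2022, §6.1 (circuit size: wires vs. gates; cf. LST 2025 §2)] -/
theorem newIdx_lt_of_keep {j i : ℕ} (hji : j < i) (hk : keep G j = true) : newIdx G j < newIdx G i := by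
  have h1 : newIdx G (j + 1) = newIdx G j + 1 := by rw [newIdx_succ, if_pos hk]
  have h2 : newIdx G (j + 1) ≤ newIdx G i := newIdx_mono (G := G) (show j + 1 ≤ i by omega)
  omega

/-- Bookkeeping for the circuit projections (`pick_succ`). [cite: AndrewsForbes2022, §6.1 (circuit size: wires vs. gates; cf. LST 2025 §2)] -/
theorem pick_succ {α : Type*} (i : ℕ) (V : List α) (dflt : α) :
    pick G (i + 1) V dflt = pick G i V dflt ++ (if keep G i then [V.getD i dflt] else []) := by
  simp only [pick, List.range_succ, List.filter_append, List.map_append]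
  congr 1
  by_cases h : keep G i = true <;> simp [h]

/-- Bookkeeping for the circuit projections (`length_pick`). [cite: AndrewsForbes2022, §6.1 (circuit size: wires vs. gates; cf. LST 2025 §2)] -/
theorem length_pick {α : Type*} (i : ℕ) (V : List α) (dflt : α) :
    (pick G i V dflt).length = newIdx G i := by
  simp [pick, newIdx]

/-- Picking only reads the first `i` entries. [cite: AndrewsForbes2022, §6.1 (circuit size: wires vs. gates; cf. LST 2025 §2)] -/
theorem pick_append_of_length_eq {α : Type*} (i : ℕ) (V W : List α) (hV : V.length = i) (dflt : α) :
    pick G i (V ++ W) dflt = pick G i V dflt := by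
  unfold pick
  refine List.map_congr_left fun j hj => ?_
  have hji : j < i := by
    have := List.mem_filter.1 hj
    simpa using this.1
  rw [List.getD_eq_getElem?_getD, List.getD_eq_getElem?_getD, List.getElem?_append_left (by omega)]

/-- The picked list at the new index of a kept gate `j < i` holds the old entry `j`. [cite: AndrewsForbes2022, §6.1 (circuit size: wires vs. gates; cf. LST 2025 §2)] -/
theorem getD_pick_newIdx {α : Type*} {i j : ℕ} (hji : j < i) (hk : keep G j = true) (V : List α)
    (dflt : α) : (pick G i V dflt).getD (newIdx G j) dflt = V.getD j dflt := by
  induction i with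
  | zero => exact absurd hji (Nat.not_lt_zero _)
  | succ i ih =>
    rw [pick_succ, List.getD_eq_getElem?_getD]
    rcases Nat.lt_succ_iff_lt_or_eq.1 hji with h | rfl
    · rw [List.getElem?_append_left (by rw [length_pick]; exact newIdx_lt_of_keep h hk),
        ← List.getD_eq_getElem?_getD, ih h]
    · rw [if_pos hk, List.getElem?_append_right (by rw [length_pick]), length_pick, Nat.sub_self]
      simp

section Values

variable [CommSemiring k]

/-- The value of an empty gate is its constant. [cite: AndrewsForbes2022, §6.1 (circuit size: wires vs. gates; cf. LST 2025 §2)] -/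
theorem getD_gateValues_of_not_keep {j : ℕ} (hj : j < G.length) (hk : keep G j = false) :
    (gateValues G).getD j 0 = C (cval G j) := by
  obtain ⟨g, hg⟩ : ∃ g, G[j]? = some g := ⟨G[j], List.getElem?_eq_getElem hj⟩
  rw [keep_of_getElem? hg] at hk
  have h0 : g.fanIn = 0 := by simpa using hk
  have hval := gateValues_getElem? G j g hg
  rw [List.getD_eq_getElem?_getD, hval, Option.getD_some]
  rcases Gate.eq_of_fanIn_eq_zero h0 with rfl | rfl
  · simp [Gate.eval, cval, hg]
  · simp [Gate.eval, cval, hg]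

/-- **Operand rewriting is semantic**: the rewritten operand, read against the picked values,
has the value of the original operand read against the first `i` values. [cite: AndrewsForbes2022, §6.1 (circuit size: wires vs. gates; cf. LST 2025 §2)] -/
theorem eval_rwOp {i : ℕ} (hi : i ≤ G.length) (u : Operand k σ) :
    (rwOp G i u).eval (pick G i (gateValues G) 0) = u.eval (gateValues (G.take i)) := by
  cases u with
  | var x => rfl
  | const c => rfl
  | gate j =>
    simp only [rwOp, Operand.eval]
    rw [gateValues_take_eq_take]
    by_cases hji : j < i
    · rw [if_pos hji]
      have htake : ((gateValues G).take i).getD j 0 = (gateValues G).getD j 0 := by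
        rw [List.getD_eq_getElem?_getD, List.getD_eq_getElem?_getD, List.getElem?_take,
          if_pos hji]
      rw [htake]
      by_cases hk : keep G j = true
      · rw [if_pos hk]
        exact getD_pick_newIdx hji hk _ _
      · rw [if_neg hk]
        rw [getD_gateValues_of_not_keep (by omega) (by simpa using hk)]
    · rw [if_neg hji]
      simp only [C_0]
      rw [List.getD_eq_getElem?_getD, List.getElem?_eq_none_iff.2 (by
        rw [List.length_take, gateValues_length]; omega)]
      rfl

/-- **The pruned gate list has the picked value list.** [cite: AndrewsForbes2022, §6.1 (circuit size: wires vs. gates; cf. LST 2025 §2)] -/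
theorem gateValues_newGates {i : ℕ} (hi : i ≤ G.length) :
    gateValues (newGates G i) = pick G i (gateValues G) 0 := by
  induction i with
  | zero => simp [newGates, pick, gateValues]
  | succ i ih =>
    have hi' : i < G.length := hi
    obtain ⟨g, hg⟩ : ∃ g, G[i]? = some g := ⟨G[i], List.getElem?_eq_getElem hi'⟩
    have htake : G.take (i + 1) = G.take i ++ [g] := by
      rw [List.take_add_one, hg]; rfl
    have hlen : (G.take i).length = i := by rw [List.length_take]; omega
    have hnew : newGates G (i + 1) = newGates G i ++
        (if keep G i then [g.mapOps (rwOp G i)] else []) := by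
      simp only [newGates, htake, List.mapIdx_concat, List.filter_append, hlen]
      congr 1
      rw [keep_of_getElem? hg]
      by_cases h0 : g.fanIn ≠ 0
      · simp [h0]
      · simp [h0]
    rw [hnew, pick_succ]
    by_cases hk : keep G i = true
    · rw [if_pos hk, if_pos hk, gateValues_append_singleton, ih hi'.le]
      congr 1
      have hval : (gateValues G).getD i 0 = g.eval (gateValues (G.take i)) := by
        rw [List.getD_eq_getElem?_getD, gateValues_getElem? G i g hg, Option.getD_some]
      rw [hval, Gate.eval_mapOps]
      intro u _
      exact eval_rwOp hi'.le u
    · have hk' : keep G i = false := by simpa using hk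
      rw [hk']
      simpa using ih hi'.le

end Values

section Depths

variable (w : Gate k σ → ℕ) (hw : ∀ (f : Operand k σ → Operand k σ) (g : Gate k σ), w (g.mapOps f) = w g)
include hw

omit hw in
/-- Operand rewriting does not increase depths, given that the new depth list is dominated by the
picked old depths. [cite: AndrewsForbes2022, §6.1 (circuit size: wires vs. gates; cf. LST 2025 §2)] -/
theorem depthIn_rwOp_le [Zero k] [One k] {i : ℕ} {D : List ℕ}
    (hle : ∀ j < i, keep G j = true → D.getD (newIdx G j) 0 ≤ (gateWDepths w G).getD j 0)
    (u : Operand k σ) :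
    (rwOp G i u).depthIn D ≤ u.depthIn (gateWDepths w (G.take i)) := by
  cases u with
  | var x => exact le_rfl
  | const c => exact le_rfl
  | gate j =>
    simp only [rwOp, Operand.depthIn]
    by_cases hji : j < i
    · rw [if_pos hji]
      by_cases hk : keep G j = true
      · rw [if_pos hk]
        refine (hle j hji hk).trans (le_of_eq ?_)
        rw [gateWDepths_take_eq_take, List.getD_eq_getElem?_getD, List.getD_eq_getElem?_getD,
          List.getElem?_take, if_pos hji]
      · rw [if_neg hk]; exact Nat.zero_le _
    · rw [if_neg hji]; exact Nat.zero_le _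

/-- **The pruned gate list has dominated depths.** [cite: AndrewsForbes2022, §6.1 (circuit size: wires vs. gates; cf. LST 2025 §2)] -/
theorem gateWDepths_newGates_le [Zero k] [One k] {i : ℕ} (hi : i ≤ G.length) :
    (gateWDepths w (newGates G i)).length = newIdx G i ∧
      ∀ j < i, keep G j = true →
        (gateWDepths w (newGates G i)).getD (newIdx G j) 0 ≤ (gateWDepths w G).getD j 0 := by
  induction i with
  | zero =>
    refine ⟨by simp [newGates, newIdx, gateWDepths], fun j hj => absurd hj (Nat.not_lt_zero _)⟩
  | succ i ih =>
    have hi' : i < G.length := hi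
    obtain ⟨hlenD, hle⟩ := ih hi'.le
    obtain ⟨g, hg⟩ : ∃ g, G[i]? = some g := ⟨G[i], List.getElem?_eq_getElem hi'⟩
    have htake : G.take (i + 1) = G.take i ++ [g] := by
      rw [List.take_add_one, hg]; rfl
    have hlen : (G.take i).length = i := by rw [List.length_take]; omega
    have hnew : newGates G (i + 1) = newGates G i ++
        (if keep G i then [g.mapOps (rwOp G i)] else []) := by
      simp only [newGates, htake, List.mapIdx_concat, List.filter_append, hlen]
      congr 1
      rw [keep_of_getElem? hg]
      by_cases h0 : g.fanIn ≠ 0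
      · simp [h0]
      · simp [h0]
    rw [hnew, newIdx_succ]
    by_cases hk : keep G i = true
    · rw [if_pos hk, if_pos hk, gateWDepths_append_singleton]
      refine ⟨by rw [List.length_append, hlenD]; rfl, fun j hj hkj => ?_⟩
      set Dnew := gateWDepths w (newGates G i)
      rcases Nat.lt_succ_iff_lt_or_eq.1 hj with h | rfl
      · rw [List.getD_eq_getElem?_getD, List.getElem?_append_left (by
          rw [hlenD]; exact newIdx_lt_of_keep h hkj), ← List.getD_eq_getElem?_getD]
        exact hle j h hkj
      · rw [List.getD_eq_getElem?_getD, List.getElem?_append_right (by rw [hlenD]), hlenD,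
          Nat.sub_self, List.getElem?_cons_zero, Option.getD_some]
        -- the old depth of gate `i`
        rw [List.getD_eq_getElem?_getD, gateWDepths_getElem? w G j g hg, Option.getD_some, hw,
          Gate.args_mapOps, List.map_map]
        refine Nat.add_le_add_left ?_ _
        refine foldr_max_map_le_of_forall _ _ _ fun u _ => ?_
        exact depthIn_rwOp_le w hle u
    · have hk' : keep G i = false := by simpa using hk
      simp only [hk', if_false, List.append_nil, add_zero, Bool.false_eq_true]
      refine ⟨hlenD, fun j hj hkj => ?_⟩
      rcases Nat.lt_succ_iff_lt_or_eq.1 hj with h | rfl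
      · exact hle j h hkj
      · rw [hk'] at hkj; exact absurd hkj Bool.false_ne_true

end Depths

end EmptyGatePruning

open EmptyGatePruning

/-- **The pruned circuit** (empty-gate pruning): empty gates (`sum []`, `prod []`) are removed and the references to
them replaced by their constant values. [folklore] -/
def pruneEmpty [Zero k] [One k] (P : ArithCircuit k σ) : ArithCircuit k σ where
  gates := newGates P.gates P.size
  output := rwOp P.gates P.size P.output

/-- Pruning keeps the computed polynomial. [cite: AndrewsForbes2022, §6.1 (circuit size: wires vs. gates; cf. LST 2025 §2)] -/
theorem eval_pruneEmpty [CommSemiring k] (P : ArithCircuit k σ) : P.pruneEmpty.eval = P.eval := by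
  change (rwOp P.gates P.size P.output).eval (gateValues (newGates P.gates P.size)) =
    P.output.eval (gateValues P.gates)
  have hs : P.size ≤ P.gates.length := le_rfl
  have ht : P.gates.take P.size = P.gates := List.take_of_length_le hs
  rw [gateValues_newGates hs, eval_rwOp hs, ht]

/-- Every gate of the pruned circuit has an operand, so it has at most as many gates as wires.
[cite: AndrewsForbes2022, §6.1 (circuit size: wires vs. gates; cf. LST 2025 §2)] -/
theorem size_pruneEmpty_le_edgeSize [Zero k] [One k] (P : ArithCircuit k σ) :
    P.pruneEmpty.size ≤ P.pruneEmpty.edgeSize := by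
  unfold size edgeSize pruneEmpty newGates
  set L := ((P.gates.take P.gates.length).mapIdx fun j g => g.mapOps (rwOp P.gates j)).filter
    fun g => decide (g.fanIn ≠ 0)
  have h : ∀ g ∈ L, 1 ≤ g.fanIn := by
    intro g hg
    have := (List.mem_filter.1 hg).2
    have : g.fanIn ≠ 0 := by simpa using this
    omega
  calc L.length = (L.map fun _ => 1).sum := by simp
    _ ≤ (L.map Gate.fanIn).sum := List.sum_le_sum (fun g hg => h g hg)

/-- Pruning does not increase the number of wires. [cite: AndrewsForbes2022, §6.1 (circuit size: wires vs. gates; cf. LST 2025 §2)] -/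
theorem edgeSize_pruneEmpty_le [Zero k] [One k] (P : ArithCircuit k σ) : P.pruneEmpty.edgeSize ≤ P.edgeSize := by
  have hs : P.gates.length ≤ P.size := le_rfl
  unfold edgeSize pruneEmpty newGates
  dsimp only
  rw [List.take_of_length_le hs]
  calc (((P.gates.mapIdx fun j g => g.mapOps (rwOp P.gates j)).filter
          fun g => decide (g.fanIn ≠ 0)).map Gate.fanIn).sum
      ≤ ((P.gates.mapIdx fun j g => g.mapOps (rwOp P.gates j)).map Gate.fanIn).sum :=
        List.Sublist.sum_le_sum (List.filter_sublist.map _) (fun _ _ => Nat.zero_le _)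
    _ = (P.gates.map Gate.fanIn).sum := by
        congr 1
        apply List.ext_getElem
        · simp
        · intro i h₁ h₂
          simp [List.getElem_mapIdx]

/-- Pruning does not increase the product-depth. [cite: AndrewsForbes2022, §6.1 (circuit size: wires vs. gates; cf. LST 2025 §2)] -/
theorem productDepth_pruneEmpty_le [Zero k] [One k] (P : ArithCircuit k σ) :
    P.pruneEmpty.productDepth ≤ P.productDepth := by
  unfold productDepth wdepth
  set w : Gate k σ → ℕ := fun g => if g.isProd then 1 else 0 with hwdef
  change (rwOp P.gates P.size P.output).depthIn (gateWDepths w (newGates P.gates P.size)) ≤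
    P.output.depthIn (gateWDepths w P.gates)
  have hw : ∀ (f : Operand k σ → Operand k σ) (g : Gate k σ), w (g.mapOps f) = w g := by
    intro f g; simp [hwdef]
  have hs : P.size ≤ P.gates.length := le_rfl
  obtain ⟨-, hle⟩ := gateWDepths_newGates_le (G := P.gates) w hw hs
  have h := depthIn_rwOp_le (G := P.gates) w hle P.output
  have ht : P.gates.take P.size = P.gates := List.take_of_length_le hs
  rwa [ht] at h

/-- **`size ≤ edgeSize` normal form**: every circuit can be replaced by one computing the same
polynomial, of no larger product-depth and no more wires, whose number of gates is at most its
number of wires. [cite: AndrewsForbes2022, §6.1 (circuit size: wires vs. gates; cf. LST 2025 §2)] -/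
theorem exists_size_le_edgeSize [CommSemiring k] (P : ArithCircuit k σ) :
    ∃ P' : ArithCircuit k σ, P'.eval = P.eval ∧ P'.productDepth ≤ P.productDepth ∧
      P'.edgeSize ≤ P.edgeSize ∧ P'.size ≤ P'.edgeSize :=
  ⟨P.pruneEmpty, P.eval_pruneEmpty, P.productDepth_pruneEmpty_le, P.edgeSize_pruneEmpty_le,
    P.size_pruneEmpty_le_edgeSize⟩

/-! ### Substituting variables by variables or constants -/

/-- Substitute each variable by a variable or a constant, operand level. [folklore] -/
def Operand.substVC (s : σ → τ ⊕ k) : Operand k σ → Operand k τ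
  | .var i => Sum.elim .var .const (s i)
  | .const c => .const c
  | .gate j => .gate j

/-- Substitute each variable by a variable or a constant, gate level. [folklore] -/
def Gate.substVC (s : σ → τ ⊕ k) : Gate k σ → Gate k τ
  | .sum args => .sum (args.map fun a => (a.1, a.2.substVC s))
  | .prod args => .prod (args.map (Operand.substVC s))

/-- **Projection of a circuit**: substitute each variable by a variable or a constant
(`s x = inl y`: `x ↦ y`; `s x = inr c`: `x ↦ c`). Same gates, same wires, same depths; computes
the substituted polynomial (`eval_substVC`). [folklore] -/
def substVC (s : σ → τ ⊕ k) (P : ArithCircuit k σ) : ArithCircuit k τ where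
  gates := P.gates.map (Gate.substVC s)
  output := P.output.substVC s

/-- The polynomial substitution underlying `substVC`. [folklore] -/
def substVCFun [CommSemiring k] (s : σ → τ ⊕ k) : σ → MvPolynomial τ k :=
  fun x => Sum.elim X C (s x)

/-- Bookkeeping for the circuit projections (`Gate.args_substVC`). [cite: Burgisser2000, Def. 2.1 and Rem. 2.2] -/
@[simp] theorem Gate.args_substVC (s : σ → τ ⊕ k) (g : Gate k σ) :
    (g.substVC s).args = g.args.map (Operand.substVC s) := by
  cases g <;> simp [Gate.substVC, Gate.args, List.map_map, Function.comp_def]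

/-- Bookkeeping for the circuit projections (`Gate.fanIn_substVC`). [cite: Burgisser2000, Def. 2.1 and Rem. 2.2] -/
@[simp] theorem Gate.fanIn_substVC (s : σ → τ ⊕ k) (g : Gate k σ) :
    (g.substVC s).fanIn = g.fanIn := by
  simp [Gate.fanIn]

/-- Bookkeeping for the circuit projections (`Gate.isProd_substVC`). [cite: Burgisser2000, Def. 2.1 and Rem. 2.2] -/
@[simp] theorem Gate.isProd_substVC (s : σ → τ ⊕ k) (g : Gate k σ) :
    (g.substVC s).isProd = g.isProd := by
  cases g <;> rfl

/-- Bookkeeping for the circuit projections (`size_substVC`). [cite: Burgisser2000, Def. 2.1 and Rem. 2.2] -/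
@[simp] theorem size_substVC (s : σ → τ ⊕ k) (P : ArithCircuit k σ) :
    (P.substVC s).size = P.size := by
  simp [substVC, size]

/-- Bookkeeping for the circuit projections (`edgeSize_substVC`). [cite: Burgisser2000, Def. 2.1 and Rem. 2.2] -/
@[simp] theorem edgeSize_substVC (s : σ → τ ⊕ k) (P : ArithCircuit k σ) :
    (P.substVC s).edgeSize = P.edgeSize := by
  simp [substVC, edgeSize, List.map_map, Function.comp_def]

section Eval

variable [CommSemiring k]

/-- Bookkeeping for the circuit projections (`Operand.eval_substVC`). [cite: Burgisser2000, Def. 2.1 and Rem. 2.2] -/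
theorem Operand.eval_substVC (s : σ → τ ⊕ k) (vals : List (MvPolynomial σ k)) (u : Operand k σ) :
    (u.substVC s).eval (vals.map (aeval (substVCFun s))) = aeval (substVCFun s) (u.eval vals) := by
  cases u with
  | var i =>
    simp only [Operand.substVC, Operand.eval, aeval_X, substVCFun]
    cases s i <;> rfl
  | const c => simp [Operand.substVC, Operand.eval]
  | gate j =>
    simp only [Operand.substVC, Operand.eval, List.getD_eq_getElem?_getD, List.getElem?_map]
    cases vals[j]? <;> simp

/-- Bookkeeping for the circuit projections (`Gate.eval_substVC`). [cite: Burgisser2000, Def. 2.1 and Rem. 2.2] -/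
theorem Gate.eval_substVC (s : σ → τ ⊕ k) (vals : List (MvPolynomial σ k)) (g : Gate k σ) :
    (g.substVC s).eval (vals.map (aeval (substVCFun s))) = aeval (substVCFun s) (g.eval vals) := by
  cases g with
  | sum args =>
    simp only [Gate.substVC, Gate.eval, List.map_map, map_list_sum]
    congr 1
    simp [Function.comp_def, Operand.eval_substVC]
  | prod args =>
    simp only [Gate.substVC, Gate.eval, List.map_map, map_list_prod]
    congr 1
    simp [Function.comp_def, Operand.eval_substVC]

/-- Bookkeeping for the circuit projections (`gateValues_substVC`). [cite: Burgisser2000, Def. 2.1 and Rem. 2.2] -/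
theorem gateValues_substVC (s : σ → τ ⊕ k) (gs : List (Gate k σ)) :
    gateValues (gs.map (Gate.substVC s)) = (gateValues gs).map (aeval (substVCFun s)) := by
  induction gs using List.reverseRecOn with
  | nil => rfl
  | append_singleton gs g ih =>
    rw [List.map_append, List.map_singleton, gateValues_append_singleton,
      gateValues_append_singleton, ih, Gate.eval_substVC, List.map_append, List.map_singleton]

/-- **Semantics of the projection**: `substVC s P` computes `P.eval` with `x ↦ y` / `x ↦ c`
substituted. [cite: Burgisser2000, Def. 2.1 and Rem. 2.2] -/
theorem eval_substVC (s : σ → τ ⊕ k) (P : ArithCircuit k σ) :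
    (P.substVC s).eval = aeval (substVCFun s) P.eval := by
  change (P.output.substVC s).eval (gateValues (P.gates.map (Gate.substVC s))) = _
  rw [gateValues_substVC, Operand.eval_substVC]
  rfl

end Eval

section Depth

variable (w : Gate k σ → ℕ) (w' : Gate k τ → ℕ) (hw : ∀ (s : σ → τ ⊕ k) (g : Gate k σ), w' (g.substVC s) = w g)
include hw

omit hw in
/-- Bookkeeping for the circuit projections (`Operand.depthIn_substVC`). [cite: Burgisser2000, Def. 2.1 and Rem. 2.2] -/
theorem Operand.depthIn_substVC (s : σ → τ ⊕ k) (ds : List ℕ) (u : Operand k σ) :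
    (u.substVC s).depthIn ds = u.depthIn ds := by
  cases u with
  | var i => simp only [Operand.substVC, Operand.depthIn]; cases s i <;> rfl
  | const c => rfl
  | gate j => rfl

/-- Bookkeeping for the circuit projections (`gateWDepths_substVC`). [cite: Burgisser2000, Def. 2.1 and Rem. 2.2] -/
theorem gateWDepths_substVC (s : σ → τ ⊕ k) (gs : List (Gate k σ)) :
    gateWDepths w' (gs.map (Gate.substVC s)) = gateWDepths w gs := by
  induction gs using List.reverseRecOn with
  | nil => rfl
  | append_singleton gs g ih =>
    rw [List.map_append, List.map_singleton, gateWDepths_append_singleton,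
      gateWDepths_append_singleton, ih, hw, Gate.args_substVC, List.map_map]
    have hl : g.args.map (Operand.depthIn (gateWDepths w gs) ∘ Operand.substVC s) =
        g.args.map (Operand.depthIn (gateWDepths w gs)) :=
      List.map_congr_left fun u _ => Operand.depthIn_substVC s _ u
    rw [hl]

/-- Bookkeeping for the circuit projections (`wdepth_substVC`). [cite: Burgisser2000, Def. 2.1 and Rem. 2.2] -/
theorem wdepth_substVC (s : σ → τ ⊕ k) (P : ArithCircuit k σ) :
    (P.substVC s).wdepth w' = P.wdepth w := by
  unfold wdepth
  change (P.output.substVC s).depthIn (gateWDepths w' (P.gates.map (Gate.substVC s))) = _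
  rw [gateWDepths_substVC w w' hw, Operand.depthIn_substVC]

end Depth

/-- The projection keeps the product-depth. [cite: Burgisser2000, Def. 2.1 and Rem. 2.2] -/
@[simp] theorem productDepth_substVC (s : σ → τ ⊕ k) (P : ArithCircuit k σ) :
    (P.substVC s).productDepth = P.productDepth := by
  unfold productDepth
  exact wdepth_substVC (fun g => if g.isProd then 1 else 0) (fun g => if g.isProd then 1 else 0)
    (fun s g => by simp) s P

end ArithCircuit

/-! ### `IMM_{n,d'}` is a projection of `IMM_{n,d}` -/

section IMM

variable (K : Type u) [CommSemiring K]

/-- For any substitution `g`, `aeval g ((X^{(0)} ⋯ X^{(d-1)})_{i j}) = (∏_t (g (t, ·, ·)))_{i j}`.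
[cite: LimayeSrinivasanTavenas2025, §2.2] -/
theorem aeval_immMatrix_apply {n : Type} [Fintype n] [DecidableEq n] {d : ℕ} {S : Type*}
    [CommSemiring S] [Algebra K S] (g : Fin d × n × n → S) (i j : n) :
    aeval g (immMatrix n d K i j) =
      ((List.finRange d).map fun t => Matrix.of fun i j => g (t, i, j)).prod i j := by
  unfold immMatrix
  have h : aeval g ((((List.finRange d).map fun t =>
      (Matrix.mvPolynomialX n n K).map (rename fun ij : n × n => (t, ij))).prod) i j) =
      ((aeval g).mapMatrix (((List.finRange d).map fun t =>
      (Matrix.mvPolynomialX n n K).map (rename fun ij : n × n => (t, ij))).prod)) i j := by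
    rw [AlgHom.mapMatrix_apply, Matrix.map_apply]
  rw [h, map_list_prod, List.map_map]
  have hl : ((List.finRange d).map ((aeval g).mapMatrix ∘ fun t =>
      (Matrix.mvPolynomialX n n K).map (rename fun ij : n × n => (t, ij)))) =
      (List.finRange d).map fun t => Matrix.of fun i j => g (t, i, j) := by
    refine List.map_congr_left fun t _ => ?_
    ext i j
    simp [Matrix.map_apply, Matrix.mvPolynomialX_apply]
  rw [hl]

/-- **The truncating projection**: keep the variables of the first `d'` matrices, replace the
matrices `t ≥ d'` by the identity matrix (`x^{(t)}_{ij} ↦ δ_{ij}`). [folklore] -/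
def immTrunc (n d d' : ℕ) : Fin d × Fin n × Fin n → (Fin d' × Fin n × Fin n) ⊕ K :=
  fun v => if h : (v.1 : ℕ) < d' then Sum.inl (⟨v.1, h⟩, v.2)
    else Sum.inr (if v.2.1 = v.2.2 then 1 else 0)

/-- **`IMM_{n,d'}` is a projection of `IMM_{n,d}` for `d' ≤ d`**: substituting the identity matrix
for `X^{(t)}`, `t ≥ d'`, in `(X^{(0)} ⋯ X^{(d-1)})_{ij}` gives `(X^{(0)} ⋯ X^{(d'-1)})_{ij}`.
[cite: LimayeSrinivasanTavenas2025, §2] -/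
theorem aeval_immTrunc_immMatrix {n d d' : ℕ} (hd : d' ≤ d) (i j : Fin n) :
    aeval (fun v => Sum.elim X C (immTrunc K n d d' v)) (immMatrix (Fin n) d K i j) =
      immMatrix (Fin n) d' K i j := by
  rw [aeval_immMatrix_apply]
  set A : Fin d → Matrix (Fin n) (Fin n) (MvPolynomial (Fin d' × Fin n × Fin n) K) :=
    fun t => Matrix.of fun i j => Sum.elim X C (immTrunc K n d d' (t, i, j)) with hA
  set B : Fin d' → Matrix (Fin n) (Fin n) (MvPolynomial (Fin d' × Fin n × Fin n) K) :=
    fun t => (Matrix.mvPolynomialX (Fin n) (Fin n) K).map (rename fun ij : Fin n × Fin n => (t, ij))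
    with hB
  have hApos : ∀ (t : Fin d) (ht : (t : ℕ) < d'), A t = B ⟨t, ht⟩ := by
    intro t ht
    ext i j
    simp [hA, hB, immTrunc, ht, Matrix.mvPolynomialX_apply]
  have hAneg : ∀ t : Fin d, ¬ (t : ℕ) < d' → A t = 1 := by
    intro t ht
    ext i j
    simp only [hA, immTrunc, Matrix.of_apply, ht, dite_false, Sum.elim_inr, Matrix.one_apply]
    split_ifs <;> simp
  have hlist : (List.finRange d).map A = (List.finRange d').map B ++ List.replicate (d - d') 1 := by
    apply List.ext_getElem
    · simp only [List.length_map, List.length_finRange, List.length_append, List.length_replicate]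
      omega
    · intro m h₁ h₂
      rw [List.length_map, List.length_finRange] at h₁
      have hval : (((List.finRange d)[m]'(by simpa using h₁) : Fin d) : ℕ) = m := by simp
      rw [List.getElem_map]
      by_cases hm : m < d'
      · have hval' : (((List.finRange d')[m]'(by simpa using hm) : Fin d') : ℕ) = m := by simp
        rw [List.getElem_append_left (by simpa using hm), List.getElem_map,
          hApos _ (by rw [hval]; exact hm)]
        congr 1
        exact Fin.ext (by rw [Fin.val_mk, hval, hval'])
      · rw [List.getElem_append_right (by simpa using hm), List.getElem_replicate,
          hAneg _ (by rw [hval]; exact hm)]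
  change ((List.finRange d).map A).prod i j = ((List.finRange d').map B).prod i j
  rw [hlist, List.prod_append, List.prod_replicate, one_pow, mul_one]

end IMM

end Literature.Computability.AlgebraicComplexity
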